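import Summits.QuantumFields.BalabanUV.T4Continuum.Spine.NE2KingTransplant

/-!
# T⁴ programme, spine node NE2 (U1a) — THE KING TRANSPLANT, leaf (H1) at a background:
# uniform coercivity of the tower from coercivity AT `U = 1` plus a k-uniform form-smallness of `Δ_k(U_k) − Δ_k(1)`

Cell `pub-balaban`, unit `b2b-balaban-t4-ne2-p3` (ROUND-2 technique-distinct prover #3 on BINDER row NE2, literature
transplant); companion of `Spine/NE2KingTransplant` (p206677) and of the skeleton `t4/skeletons/NE2-t4-ne2-p3.md`, leaf L01b.

THE GAP THIS FILE CLOSES (skeleton §2, row (P1-i), background column).  King's hypothesis (4.33) p. 674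
*"C_Ω^{(k)}(s)⁻¹ ≥ γ₀I"* is, for Bałaban's unit-lattice actions at a background `U`, printed only as an ASSERTION
([Balaban1985BackgroundPropagators] p. 428, the uniform lower bound of `C*Δ_kC` for general `U`; cell GAPS G-B9-09) and is
therefore NOT citable.  The transplant's one-line fix: coercivity at `U = 1` (printed AND kernel: [Balaban1984PropagatorsII]
(2.157), `B6Cov2156Torus.lowerOnConstrainedT_of_represents`; King's own (4.33) at `A = 0`: `King1986.Torus.king433`) plus a
k-UNIFORM FORM-SMALLNESS `|⟨x, (Δ_k(U_k) − Δ_k(1))x⟩| ≤ δ‖x‖²`, `δ < γ₀` — a ONE-RUN, small-field statement (the unit-layer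
reading of the row owner's (H-bd) `PerturbationLaws.opNorm_P_mul_inv_le`, lineage t4-ne2-p1) — gives the leaf
`UniformCoercive D B (γ₀ − δ)` of the tower assembly.  Kernel-checked below (`uniformCoercive_of_formSmall`), together with
the same statement for a perturbed `B` and the constrained (sandwiched) form `x ↦ Ex` used by the δ-constraint shape
(`coercive_sandwich_of_formSmall`).  [folklore] quadratic-form bookkeeping; nothing printed is asserted; no carrier of
Bałaban's operators is constructed.  NOT summit progress; spine 0/9.  HONEST DEPENDENCY: continuum YM on T⁴ ⇐ BetaPertH ∧
nine spine estimates (0/9 proved); BetaPertH ⇐ (D1) ∧ (D4) ∧ CAP+tail; G-an2-4 gates asym, D1 and NE2/3/4.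
-/

noncomputable section

open Matrix
open Literature.MathematicalPhysics.QuantumFieldTheory.Balaban1983to89.QGQInverse (Coercive)
open Summit.QuantumFields.BalabanUV.T4Continuum.NE2KingTransplant (UniformCoercive)

namespace Summit.QuantumFields.BalabanUV.T4Continuum.NE2KingTransplantCoercive

variable {n : Type*} [Fintype n] [DecidableEq n]

/-- **Leaf (H1b) — k-uniform FORM-SMALLNESS of the background perturbation of the tower**: every `D k` differs from the
reference operator `D₀` (the `U = 1` action) by at most `δ` in quadratic form.  ONE-RUN (no spacing difference): the
unit-layer, quadratic-form reading of «small field ⟹ small perturbation» ([B9] Thm 3.4's radius a₁; row owner's (H-bd)).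
[folklore] -/
def UniformFormSmall (D : ℕ → Matrix n n ℝ) (D₀ : Matrix n n ℝ) (δ : ℝ) : Prop :=
  ∀ k (x : n → ℝ), |x ⬝ᵥ ((D k - D₀) *ᵥ x)| ≤ δ * (x ⬝ᵥ x)

omit [DecidableEq n] in
/-- **perturbation of coercivity by a form-small operator**: `S ≥ γ` and `|⟨x,(T − S)x⟩| ≤ δ‖x‖²` ⟹ `T ≥ γ − δ`.
[folklore] -/
theorem coercive_of_formSmall {S T : Matrix n n ℝ} {γ δ : ℝ} (hS : Coercive S γ)
    (hδ : ∀ x : n → ℝ, |x ⬝ᵥ ((T - S) *ᵥ x)| ≤ δ * (x ⬝ᵥ x)) : Coercive T (γ - δ) := by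
  intro x
  have h1 := hS x
  have h2 := hδ x
  have e : x ⬝ᵥ (T *ᵥ x) = x ⬝ᵥ (S *ᵥ x) + x ⬝ᵥ ((T - S) *ᵥ x) := by
    rw [Matrix.sub_mulVec, dotProduct_sub]; ring
  rw [e, sub_mul]
  have h3 : -(δ * (x ⬝ᵥ x)) ≤ x ⬝ᵥ ((T - S) *ᵥ x) := by
    have := neg_abs_le (x ⬝ᵥ ((T - S) *ᵥ x)); linarith
  linarith

omit [DecidableEq n] in
/-- **LEAF (H1) OF THE TOWER FROM (H1) AT `U = 1` + (H1b)** (kernel): `D₀ + B ≥ γ₀` and `UniformFormSmall D D₀ δ` ⟹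
`UniformCoercive D B (γ₀ − δ)` — usable in `NE2KingTransplant.covarianceTowerRate_of_leaves` whenever `ρ + ρ_B < γ₀ − δ`
(small field: `δ` small). [folklore] -/
theorem uniformCoercive_of_formSmall {D : ℕ → Matrix n n ℝ} {D₀ B : Matrix n n ℝ} {γ₀ δ : ℝ}
    (h0 : Coercive (D₀ + B) γ₀) (hs : UniformFormSmall D D₀ δ) : UniformCoercive D B (γ₀ - δ) := by
  intro k
  refine coercive_of_formSmall h0 fun x => ?_
  have e : D k + B - (D₀ + B) = D k - D₀ := by abel
  rw [e]
  exact hs k x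

omit [DecidableEq n] in
/-- the same with a level-dependent `B k` that is form-close to a reference `B₀` (e.g. Bałaban's `Q̄(U)ᴴQ̄(U)` versus `QᴴQ`):
the two smallnesses add. [folklore] -/
theorem uniformCoercive_of_formSmall₂ {D Bk : ℕ → Matrix n n ℝ} {D₀ B₀ : Matrix n n ℝ} {γ₀ δ δ' : ℝ}
    (h0 : Coercive (D₀ + B₀) γ₀) (hs : UniformFormSmall D D₀ δ) (hs' : UniformFormSmall Bk B₀ δ') :
    ∀ k, Coercive (D k + Bk k) (γ₀ - (δ + δ')) := by
  intro k
  refine coercive_of_formSmall h0 fun x => ?_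
  have e : D k + Bk k - (D₀ + B₀) = (D k - D₀) + (Bk k - B₀) := by abel
  rw [e, Matrix.add_mulVec, dotProduct_add, add_mul]
  exact (abs_add_le _ _).trans (add_le_add (hs k x) (hs' k x))

omit [DecidableEq n] in
/-- **the constrained (sandwiched) form** of the δ-constraint shape: coercivity of `EᵀSE` on the constrained variables from
coercivity of `S` on the range of `E` in the form `⟨Ey, S Ey⟩ ≥ γ⟨Ey, Ey⟩ ≥ γ·c⟨y, y⟩` ([B6] (2.157): `‖CB′‖² ≥ c‖B′‖²`) and its
perturbation by a form-small `T − S`: `EᵀTE ≥ (γ − δ)·c`. [folklore] -/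
theorem coercive_sandwich_of_formSmall {S' : Type*} [Fintype S'] {E : Matrix n S' ℝ} {S T : Matrix n n ℝ}
    {γ δ c : ℝ} (hγδ : δ ≤ γ) (hS : ∀ x : n → ℝ, γ * (x ⬝ᵥ x) ≤ x ⬝ᵥ (S *ᵥ x))
    (hE : ∀ y : S' → ℝ, c * (y ⬝ᵥ y) ≤ (E *ᵥ y) ⬝ᵥ (E *ᵥ y))
    (hδ : ∀ x : n → ℝ, |x ⬝ᵥ ((T - S) *ᵥ x)| ≤ δ * (x ⬝ᵥ x)) :
    Coercive (Eᵀ * T * E) ((γ - δ) * c) := by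
  intro y
  have hT : Coercive T (γ - δ) := coercive_of_formSmall hS hδ
  have h1 := hT (E *ᵥ y)
  have h2 := hE y
  have e : y ⬝ᵥ ((Eᵀ * T * E) *ᵥ y) = (E *ᵥ y) ⬝ᵥ (T *ᵥ (E *ᵥ y)) := by
    rw [← Matrix.mulVec_mulVec, ← Matrix.mulVec_mulVec, Matrix.dotProduct_mulVec, Matrix.vecMul_transpose]
  rw [e]
  have hγδ' : 0 ≤ γ - δ := sub_nonneg.mpr hγδ
  calc (γ - δ) * c * (y ⬝ᵥ y) = (γ - δ) * (c * (y ⬝ᵥ y)) := by ring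
    _ ≤ (γ - δ) * ((E *ᵥ y) ⬝ᵥ (E *ᵥ y)) := mul_le_mul_of_nonneg_left h2 hγδ'
    _ ≤ (E *ᵥ y) ⬝ᵥ (T *ᵥ (E *ᵥ y)) := h1

end Summit.QuantumFields.BalabanUV.T4Continuum.NE2KingTransplantCoercive

end
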